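import Mathlib
import HarnessLib
import Literature.Probability.LatticeModels.LatticeGraph
import Summits.HubbardSuperconductivity.HubbardSuperconductivity.Theorems.BalabanIRBirComplexStableXYFixedVolumeExpansion
import Summits.HubbardSuperconductivity.HubbardSuperconductivity.Theorems.BalabanIRBirComplexStableXYFixedVolumeAction
import Summits.HubbardSuperconductivity.HubbardSuperconductivity.Theorems.BalabanIRBirComplexStableXYFixedVolumeLattice
import Summits.HubbardSuperconductivity.HubbardSuperconductivity.Theorems.BalabanIRBirComplexStableXYFixedVolumeTorus
import Summits.HubbardSuperconductivity.HubbardSuperconductivity.Theorems.BalabanIRBirComplexStableXYFixedVolumeCoercive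

/-!
# BalabanIR engine `BirComplexStableXY` (stmt-HubbardSuperconductivity-2080): constants of the
fixed-volume Laplace analysis that are UNIFORM over the admissible class

Support lemmas for crux 2 of route BalabanIR (`--supports stmt-HubbardSuperconductivity-2080`).
The fixed-volume stability theorem (`…FixedVolume.lean`) produces `K₁(r, c, L, M)`.  To move the
quantifier over the Fourier table `c` back outside (so that only the order of `∃ K₀` and `∀ L M`
differs from the crux) one needs the constants of the Laplace method to depend on `c` only through
the budget `B` of hypothesis (A) and the coercivity constant `c₀` of (C).  This file provides:

* `birUnif_coercive`: ONE `m = m(c₀, L, M) > 0` with `m Σδ² ≤ Re Σ_s F_c (ext δ ∘ sh s)` on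
  `[-π,π]^{Λ∖s₀}` for EVERY table `c` satisfying (C) (the comparison function
  `c₀ Σ_s Σ_d (1 − cos)` does not depend on `c`);
* `birUnif_sum_abs_form_le`, `birUnif_remainder_const_le`: the cubic-remainder constant is
  `≤ |Λ| · B` under (A) (`t³ ≤ 3! e^t`);
* `birUnif_entry_le`: the entries of the quadratic-germ array are bounded by `2 |Λ| B` under (A);
* `birUnif_O_lipschitz`, `birUnif_g_lipschitz`: the slice observable is `2`-Lipschitz for the
  sup norm.

No definitions.
-/

namespace Summit.HubbardSuperconductivity.HubbardSuperconductivity.Theorems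

open scoped BigOperators
open MeasureTheory Set Complex Filter Topology Literature.Probability.LatticeModels

section UniformCoercive

variable {r : ℕ} {L M : ℕ} [NeZero L] [NeZero M]

/-- **Uniform coercive lower bound.**  For `r ≥ 2` and `c₀ > 0` there is `m > 0`, depending only
on `c₀` and the sizes, such that for EVERY Fourier table satisfying (C),
`m Σ_j δ_j² ≤ Re Σ_s F (ext δ ∘ sh s)` on the closed cube `[-π, π]^{Λ∖s₀}`. -/
theorem birUnif_coercive (hr : 2 ≤ r) {c₀ : ℝ} (hc₀ : 0 < c₀) (s₀ : TorusSite 2 L × ZMod M) :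
    ∃ m : ℝ, 0 < m ∧ ∀ (c : ((Fin r × Fin r × Fin r) → ℤ) →₀ ℂ)
      (F : ((Fin r × Fin r × Fin r) → ℝ) → ℂ),
      (∀ φ, F φ = c.sum (fun n a => a * cexp (I * ((∑ w, (n w : ℝ) * φ w : ℝ) : ℂ)))) →
      (∀ φ : (Fin r × Fin r × Fin r) → ℝ,
        c₀ * ∑ w, ∑ w', (1 - Real.cos (φ w - φ w')) ≤ (F φ).re) →
      ∀ (sh : (TorusSite 2 L × ZMod M) → (Fin r × Fin r × Fin r) → (TorusSite 2 L × ZMod M)),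
      (∀ s w, sh s w = (s.1 + ![((w.1 : ℕ) : ZMod L), ((w.2.1 : ℕ) : ZMod L)],
        s.2 + ((w.2.2 : ℕ) : ZMod M))) →
      ∀ δ ∈ Set.pi univ (fun _ : {i // i ≠ s₀} => Icc (-Real.pi) Real.pi),
        m * ∑ j, δ j ^ 2
          ≤ (∑ s, F (fun w => (fun i => if h : i = s₀ then (0 : ℝ) else δ ⟨i, h⟩) (sh s w))).re := by
  set ext : ({i // i ≠ s₀} → ℝ) → (TorusSite 2 L × ZMod M) → ℝ :=
    fun δ i => if h : i = s₀ then (0 : ℝ) else δ ⟨i, h⟩ with hext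
  have hext_c : Continuous ext := birTorus_continuous_ext s₀
  have hext_ci : ∀ i, Continuous fun δ : {i // i ≠ s₀} → ℝ => ext δ i :=
    fun i => (continuous_apply i).comp hext_c
  -- the `c`-independent comparison function
  set P : ({i // i ≠ s₀} → ℝ) → ℝ := fun δ => c₀ * ∑ s : TorusSite 2 L × ZMod M,
      ((1 - Real.cos (ext δ s - ext δ (s + (![1, 0], 0))))
        + (1 - Real.cos (ext δ s - ext δ (s + (![0, 1], 0))))
        + (1 - Real.cos (ext δ s - ext δ (s + (0, 1))))) with hP
  have hPcont : Continuous P := by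
    refine continuous_const.mul (continuous_finsetSum _ fun s _ => ?_)
    exact ((continuous_const.sub (Real.continuous_cos.comp ((hext_ci _).sub (hext_ci _)))).add
      (continuous_const.sub (Real.continuous_cos.comp ((hext_ci _).sub (hext_ci _))))).add
      (continuous_const.sub (Real.continuous_cos.comp ((hext_ci _).sub (hext_ci _))))
  set P₂ : ({i // i ≠ s₀} → ℝ) → ℝ := fun δ => ∑ s : TorusSite 2 L × ZMod M,
      ((ext δ s - ext δ (s + (![1, 0], 0))) ^ 2 + (ext δ s - ext δ (s + (![0, 1], 0))) ^ 2
        + (ext δ s - ext δ (s + (0, 1))) ^ 2) with hP₂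
  have hP₂cont : Continuous P₂ := by
    refine continuous_finsetSum _ fun s _ => ?_
    exact ((((hext_ci _).sub (hext_ci _)).pow 2).add (((hext_ci _).sub (hext_ci _)).pow 2)).add
      (((hext_ci _).sub (hext_ci _)).pow 2)
  have hext_smul : ∀ (t : ℝ) δ i, ext (t • δ) i = t * ext δ i :=
    fun t δ i => birFixedVolume_ext_smul s₀ t δ i
  have hhom : ∀ (t : ℝ) δ, P₂ (t • δ) = t ^ 2 * P₂ δ := by
    intro t δ
    simp only [hP₂, hext_smul, Finset.mul_sum]
    refine Finset.sum_congr rfl fun s _ => ?_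
    ring
  have hP₂nn : ∀ δ, 0 ≤ P₂ δ := fun δ => Finset.sum_nonneg fun s _ => by positivity
  have hpos₂ : ∀ δ, δ ≠ 0 → 0 < P₂ δ := by
    intro δ hδ
    refine lt_of_le_of_ne (hP₂nn δ) fun h0 => hδ ?_
    have hterms := (Finset.sum_eq_zero_iff_of_nonneg (fun s _ => by positivity)).1 h0.symm
    refine birLat_eq_zero_of_diff s₀ δ fun s v hv => ?_
    have hs := hterms s (Finset.mem_univ s)
    have h1 : ext δ s - ext δ (s + (![1, 0], 0)) = 0 := by nlinarith
    have h2 : ext δ s - ext δ (s + (![0, 1], 0)) = 0 := by nlinarith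
    have h3 : ext δ s - ext δ (s + (0, 1)) = 0 := by nlinarith
    simp only [Set.mem_insert_iff, Set.mem_singleton_iff] at hv
    rcases hv with rfl | rfl | rfl
    · exact h1
    · exact h2
    · exact h3
  obtain ⟨lam₂, hlam₂, hquad⟩ := birCoercive_quadratic hP₂cont hhom hpos₂
  have hcos1 : ∀ x : ℝ, 0 ≤ 1 - Real.cos x := fun x => by linarith [Real.cos_le_one x]
  -- local bound
  have hloc : ∀ δ : {i // i ≠ s₀} → ℝ, ‖δ‖ ≤ Real.pi / 2 →
      (c₀ * (2 / Real.pi ^ 2) * lam₂) * ∑ j, δ j ^ 2 ≤ P δ := by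
    intro δ hδ
    have habs : ∀ i, |ext δ i| ≤ Real.pi / 2 := by
      refine birFixedVolume_abs_ext_le s₀ (by positivity) δ (fun j => ?_)
      have := norm_le_pi_norm δ j
      rw [Real.norm_eq_abs] at this
      exact this.trans hδ
    have hdiff : ∀ i i', |ext δ i - ext δ i'| ≤ Real.pi := by
      intro i i'
      have := abs_sub (ext δ i) (ext δ i')
      linarith [habs i, habs i']
    have hJ : ∀ i i', 2 / Real.pi ^ 2 * (ext δ i - ext δ i') ^ 2
        ≤ 1 - Real.cos (ext δ i - ext δ i') :=
      fun i i' => birCoercive_one_sub_cos (hdiff i i')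
    have hsum : 2 / Real.pi ^ 2 * P₂ δ ≤ ∑ s : TorusSite 2 L × ZMod M,
        ((1 - Real.cos (ext δ s - ext δ (s + (![1, 0], 0))))
          + (1 - Real.cos (ext δ s - ext δ (s + (![0, 1], 0))))
          + (1 - Real.cos (ext δ s - ext δ (s + (0, 1))))) := by
      rw [hP₂, Finset.mul_sum]
      refine Finset.sum_le_sum fun s _ => ?_
      have := hJ s (s + (![1, 0], 0))
      have := hJ s (s + (![0, 1], 0))
      have := hJ s (s + (0, 1))
      linarith
    have h1 := hquad δ
    have hc2 : 0 ≤ c₀ * (2 / Real.pi ^ 2) := by positivity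
    calc c₀ * (2 / Real.pi ^ 2) * lam₂ * ∑ j, δ j ^ 2
        = c₀ * (2 / Real.pi ^ 2) * (lam₂ * ∑ j, δ j ^ 2) := by ring
      _ ≤ c₀ * (2 / Real.pi ^ 2) * P₂ δ := mul_le_mul_of_nonneg_left h1 hc2
      _ = c₀ * (2 / Real.pi ^ 2 * P₂ δ) := by ring
      _ ≤ P δ := by rw [hP]; exact mul_le_mul_of_nonneg_left hsum hc₀.le
  -- zero set
  have hzero : ∀ δ ∈ Set.pi univ (fun _ : {i // i ≠ s₀} => Icc (-Real.pi) Real.pi),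
      P δ ≤ 0 → δ = 0 := by
    intro δ hδ hP0
    have hS0 : ∑ s : TorusSite 2 L × ZMod M,
        ((1 - Real.cos (ext δ s - ext δ (s + (![1, 0], 0))))
          + (1 - Real.cos (ext δ s - ext δ (s + (![0, 1], 0))))
          + (1 - Real.cos (ext δ s - ext δ (s + (0, 1))))) = 0 := by
      refine le_antisymm ?_ (Finset.sum_nonneg fun s _ => by
        linarith [hcos1 (ext δ s - ext δ (s + (![1, 0], 0))),
          hcos1 (ext δ s - ext δ (s + (![0, 1], 0))), hcos1 (ext δ s - ext δ (s + (0, 1)))])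
      by_contra hgt
      push Not at hgt
      have : 0 < P δ := by rw [hP]; exact mul_pos hc₀ hgt
      linarith
    have hterms := (Finset.sum_eq_zero_iff_of_nonneg (fun s _ => by
      linarith [hcos1 (ext δ s - ext δ (s + (![1, 0], 0))),
        hcos1 (ext δ s - ext δ (s + (![0, 1], 0))), hcos1 (ext δ s - ext δ (s + (0, 1)))])).1 hS0
    have hδπ : ∀ j, |δ j| ≤ Real.pi := by
      intro j
      rw [Set.mem_univ_pi] at hδ
      exact abs_le.2 ⟨(hδ j).1, (hδ j).2⟩
    refine birLat_eq_zero_of_cos s₀ δ hδπ fun s v hv => ?_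
    have hs := hterms s (Finset.mem_univ s)
    have e1 := hcos1 (ext δ s - ext δ (s + (![1, 0], 0)))
    have e2 := hcos1 (ext δ s - ext δ (s + (![0, 1], 0)))
    have e3 := hcos1 (ext δ s - ext δ (s + (0, 1)))
    simp only [Set.mem_insert_iff, Set.mem_singleton_iff] at hv
    rcases hv with rfl | rfl | rfl
    · show Real.cos (ext δ s - ext δ (s + (![1, 0], 0))) = 1; linarith
    · show Real.cos (ext δ s - ext δ (s + (![0, 1], 0))) = 1; linarith
    · show Real.cos (ext δ s - ext δ (s + (0, 1))) = 1; linarith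
  obtain ⟨m, hm, hmain⟩ := birCoercive_of_local hPcont (R := Real.pi) (ρ := Real.pi / 2)
    (by positivity) (by positivity) hzero hloc
  refine ⟨m, hm, fun c F hF hC sh hsh δ hδ => ?_⟩
  have hcmp : P δ ≤ (∑ s, F (fun w => ext δ (sh s w))).re :=
    birLat_coercive_compare hr hC hsh hc₀.le (ext δ)
  exact (hmain δ hδ).trans hcmp

end UniformCoercive

section UniformConstants

variable {r : ℕ} {L M : ℕ} [NeZero L] [NeZero M]

/-- At most one remaining site carries a given lattice point: `Σ_j [i = j] ≤ 1`. -/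
theorem birUnif_sum_ite_le_one (s₀ : TorusSite 2 L × ZMod M) (i : TorusSite 2 L × ZMod M) :
    (∑ j : {i // i ≠ s₀}, (if i = j.1 then (1 : ℝ) else 0)) ≤ 1 := by
  have h := birAct_sum_ite_mul_eq_ext s₀ (fun _ => (1 : ℝ)) i
  simp only [mul_one] at h
  rw [h]
  by_cases hi : i = s₀ <;> simp [hi]

/-- The `ℓ¹` coefficient norm of the linear form of a window translate is at most `|n|₁`. -/
theorem birUnif_sum_abs_form_le (s₀ : TorusSite 2 L × ZMod M)
    (sh : (TorusSite 2 L × ZMod M) → (Fin r × Fin r × Fin r) → (TorusSite 2 L × ZMod M))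
    (s : TorusSite 2 L × ZMod M) (n : (Fin r × Fin r × Fin r) → ℤ) :
    (∑ j : {i // i ≠ s₀}, |∑ w, (n w : ℝ) * (if sh s w = j.1 then (1 : ℝ) else 0)|)
      ≤ ∑ w, |(n w : ℝ)| := by
  calc (∑ j : {i // i ≠ s₀}, |∑ w, (n w : ℝ) * (if sh s w = j.1 then (1 : ℝ) else 0)|)
      ≤ ∑ j : {i // i ≠ s₀}, ∑ w, |(n w : ℝ)| * (if sh s w = j.1 then (1 : ℝ) else 0) := by
        refine Finset.sum_le_sum fun j _ => (Finset.abs_sum_le_sum_abs _ _).trans ?_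
        refine Finset.sum_le_sum fun w _ => ?_
        rw [abs_mul]
        refine mul_le_mul_of_nonneg_left (le_of_eq ?_) (abs_nonneg _)
        by_cases h : sh s w = j.1 <;> simp [h]
    _ = ∑ w, |(n w : ℝ)| * ∑ j : {i // i ≠ s₀}, (if sh s w = j.1 then (1 : ℝ) else 0) := by
        rw [Finset.sum_comm]
        simp only [Finset.mul_sum]
    _ ≤ ∑ w, |(n w : ℝ)| * 1 := by
        refine Finset.sum_le_sum fun w _ => ?_
        exact mul_le_mul_of_nonneg_left (birUnif_sum_ite_le_one s₀ (sh s w)) (abs_nonneg _)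
    _ = ∑ w, |(n w : ℝ)| := by simp

/-- `t³ ≤ 6 e^t` and `t² ≤ 2 e^t` for `t ≥ 0`. -/
theorem birUnif_pow_le_exp {t : ℝ} (ht : 0 ≤ t) :
    t ^ 3 ≤ 6 * Real.exp t ∧ t ^ 2 ≤ 2 * Real.exp t := by
  have h3 := Real.pow_div_factorial_le_exp t ht 3
  have h2 := Real.pow_div_factorial_le_exp t ht 2
  norm_num [Nat.factorial] at h3 h2
  constructor
  · rw [div_le_iff₀ (by norm_num)] at h3; linarith
  · rw [div_le_iff₀ (by norm_num)] at h2; linarith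

/-- **Uniform cubic-remainder constant.**  Under the analyticity budget (A),
`(Σ_k ‖w_k‖ (Σ_j |a_{kj}|)³)/6 ≤ |Λ| · B`. -/
theorem birUnif_remainder_const_le (c : ((Fin r × Fin r × Fin r) → ℤ) →₀ ℂ) {B : ℝ}
    (hA : c.sum (fun n a => ‖a‖ * Real.exp (∑ w, |(n w : ℝ)|)) ≤ B)
    (s₀ : TorusSite 2 L × ZMod M)
    (sh : (TorusSite 2 L × ZMod M) → (Fin r × Fin r × Fin r) → (TorusSite 2 L × ZMod M)) :
    (∑ k : (TorusSite 2 L × ZMod M) × ↥c.support, ‖c k.2‖ *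
        (∑ j : {i // i ≠ s₀}, |∑ w, ((k.2 : (Fin r × Fin r × Fin r) → ℤ) w : ℝ) *
          (if sh k.1 w = j.1 then (1 : ℝ) else 0)|) ^ 3) / 6
      ≤ Fintype.card (TorusSite 2 L × ZMod M) * B := by
  have hA' : ∑ n ∈ c.support, ‖c n‖ * Real.exp (∑ w, |(n w : ℝ)|) ≤ B := hA
  have hinner : ∀ s : TorusSite 2 L × ZMod M,
      ∑ n : ↥c.support, ‖c n‖ *
        (∑ j : {i // i ≠ s₀}, |∑ w, ((n : (Fin r × Fin r × Fin r) → ℤ) w : ℝ) *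
          (if sh s w = j.1 then (1 : ℝ) else 0)|) ^ 3 ≤ 6 * B := by
    intro s
    calc ∑ n : ↥c.support, ‖c n‖ *
          (∑ j : {i // i ≠ s₀}, |∑ w, ((n : (Fin r × Fin r × Fin r) → ℤ) w : ℝ) *
            (if sh s w = j.1 then (1 : ℝ) else 0)|) ^ 3
        ≤ ∑ n : ↥c.support, ‖c n‖ * (6 * Real.exp (∑ w, |((n : (Fin r × Fin r × Fin r) → ℤ) w : ℝ)|)) := by
          refine Finset.sum_le_sum fun n _ => mul_le_mul_of_nonneg_left ?_ (norm_nonneg _)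
          have h0 : 0 ≤ ∑ j : {i // i ≠ s₀}, |∑ w, ((n : (Fin r × Fin r × Fin r) → ℤ) w : ℝ) *
              (if sh s w = j.1 then (1 : ℝ) else 0)| := Finset.sum_nonneg fun j _ => abs_nonneg _
          have h1 := birUnif_sum_abs_form_le s₀ sh s (n : (Fin r × Fin r × Fin r) → ℤ)
          have h2 : 0 ≤ ∑ w, |((n : (Fin r × Fin r × Fin r) → ℤ) w : ℝ)| :=
            Finset.sum_nonneg fun w _ => abs_nonneg _
          exact (pow_le_pow_left₀ h0 h1 3).trans (birUnif_pow_le_exp h2).1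
      _ = 6 * ∑ n ∈ c.support, ‖c n‖ * Real.exp (∑ w, |(n w : ℝ)|) := by
          rw [Finset.mul_sum, ← Finset.sum_coe_sort c.support]
          refine Finset.sum_congr rfl fun n _ => ?_
          ring
      _ ≤ 6 * B := by linarith
  rw [Fintype.sum_prod_type]
  have : ∑ s : TorusSite 2 L × ZMod M, ∑ n : ↥c.support, ‖c n‖ *
      (∑ j : {i // i ≠ s₀}, |∑ w, ((n : (Fin r × Fin r × Fin r) → ℤ) w : ℝ) *
        (if sh s w = j.1 then (1 : ℝ) else 0)|) ^ 3
      ≤ ∑ _s : TorusSite 2 L × ZMod M, 6 * B := Finset.sum_le_sum fun s _ => hinner s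
  rw [Finset.sum_const, Finset.card_univ, nsmul_eq_mul] at this
  rw [div_le_iff₀ (by norm_num : (0 : ℝ) < 6)]
  linarith

/-- **Uniform entry bound** for the quadratic-germ array: under (A), `‖Q_{ij}‖ ≤ 2 |Λ| B`. -/
theorem birUnif_entry_le (c : ((Fin r × Fin r × Fin r) → ℤ) →₀ ℂ) {B : ℝ}
    (hA : c.sum (fun n a => ‖a‖ * Real.exp (∑ w, |(n w : ℝ)|)) ≤ B)
    (s₀ : TorusSite 2 L × ZMod M)
    (sh : (TorusSite 2 L × ZMod M) → (Fin r × Fin r × Fin r) → (TorusSite 2 L × ZMod M))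
    (i j : {i // i ≠ s₀}) :
    ‖-(∑ k : (TorusSite 2 L × ZMod M) × ↥c.support, c k.2 *
        ((∑ w, ((k.2 : (Fin r × Fin r × Fin r) → ℤ) w : ℝ) * (if sh k.1 w = i.1 then (1 : ℝ) else 0) : ℝ) : ℂ) *
        ((∑ w, ((k.2 : (Fin r × Fin r × Fin r) → ℤ) w : ℝ) * (if sh k.1 w = j.1 then (1 : ℝ) else 0) : ℝ) : ℂ))‖
      ≤ 2 * Fintype.card (TorusSite 2 L × ZMod M) * B := by
  have hA' : ∑ n ∈ c.support, ‖c n‖ * Real.exp (∑ w, |(n w : ℝ)|) ≤ B := hA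
  -- `|a_i| ≤ Σ_j |a_j| ≤ |n|₁`
  have hai : ∀ (s : TorusSite 2 L × ZMod M) (n : (Fin r × Fin r × Fin r) → ℤ) (i : {i // i ≠ s₀}),
      |∑ w, (n w : ℝ) * (if sh s w = i.1 then (1 : ℝ) else 0)| ≤ ∑ w, |(n w : ℝ)| := by
    intro s n i
    refine le_trans ?_ (birUnif_sum_abs_form_le s₀ sh s n)
    exact Finset.single_le_sum (f := fun j : {i // i ≠ s₀} =>
      |∑ w, (n w : ℝ) * (if sh s w = j.1 then (1 : ℝ) else 0)|) (fun j _ => abs_nonneg _)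
      (Finset.mem_univ i)
  rw [norm_neg]
  calc ‖∑ k : (TorusSite 2 L × ZMod M) × ↥c.support, c k.2 *
        ((∑ w, ((k.2 : (Fin r × Fin r × Fin r) → ℤ) w : ℝ) * (if sh k.1 w = i.1 then (1 : ℝ) else 0) : ℝ) : ℂ) *
        ((∑ w, ((k.2 : (Fin r × Fin r × Fin r) → ℤ) w : ℝ) * (if sh k.1 w = j.1 then (1 : ℝ) else 0) : ℝ) : ℂ)‖
      ≤ ∑ k : (TorusSite 2 L × ZMod M) × ↥c.support, ‖c k.2‖ *
          (2 * Real.exp (∑ w, |((k.2 : (Fin r × Fin r × Fin r) → ℤ) w : ℝ)|)) := by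
        refine (norm_sum_le _ _).trans (Finset.sum_le_sum fun k _ => ?_)
        rw [norm_mul, norm_mul, Complex.norm_real, Complex.norm_real, Real.norm_eq_abs,
          Real.norm_eq_abs, mul_assoc]
        refine mul_le_mul_of_nonneg_left ?_ (norm_nonneg _)
        have h1 := hai k.1 k.2 i
        have h2 := hai k.1 k.2 j
        have h0 : 0 ≤ ∑ w, |((k.2 : (Fin r × Fin r × Fin r) → ℤ) w : ℝ)| :=
          Finset.sum_nonneg fun w _ => abs_nonneg _
        have h3 := (birUnif_pow_le_exp h0).2
        calc |∑ w, ((k.2 : (Fin r × Fin r × Fin r) → ℤ) w : ℝ) * (if sh k.1 w = i.1 then (1 : ℝ) else 0)| *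
              |∑ w, ((k.2 : (Fin r × Fin r × Fin r) → ℤ) w : ℝ) * (if sh k.1 w = j.1 then (1 : ℝ) else 0)|
            ≤ (∑ w, |((k.2 : (Fin r × Fin r × Fin r) → ℤ) w : ℝ)|) *
                (∑ w, |((k.2 : (Fin r × Fin r × Fin r) → ℤ) w : ℝ)|) :=
              mul_le_mul h1 h2 (abs_nonneg _) h0
          _ = (∑ w, |((k.2 : (Fin r × Fin r × Fin r) → ℤ) w : ℝ)|) ^ 2 := (sq _).symm
          _ ≤ 2 * Real.exp (∑ w, |((k.2 : (Fin r × Fin r × Fin r) → ℤ) w : ℝ)|) := h3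
    _ = ∑ _s : TorusSite 2 L × ZMod M, 2 * ∑ n ∈ c.support, ‖c n‖ * Real.exp (∑ w, |(n w : ℝ)|) := by
        rw [Fintype.sum_prod_type]
        refine Finset.sum_congr rfl fun s _ => ?_
        rw [Finset.mul_sum, ← Finset.sum_coe_sort c.support]
        refine Finset.sum_congr rfl fun n _ => ?_
        ring
    _ ≤ ∑ _s : TorusSite 2 L × ZMod M, 2 * B :=
        Finset.sum_le_sum fun s _ => by linarith
    _ = 2 * Fintype.card (TorusSite 2 L × ZMod M) * B := by
        rw [Finset.sum_const, Finset.card_univ, nsmul_eq_mul]; ring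

end UniformConstants

section Lipschitz

variable {L M : ℕ} [NeZero L] [NeZero M]

/-- The slice sum `Σ_x e^{iθ(x,0)}` is `L²`-Lipschitz for the sup norm. -/
theorem birUnif_sliceSum_lipschitz (θ θ' : (TorusSite 2 L × ZMod M) → ℝ) :
    ‖(∑ x : TorusSite 2 L, cexp (I * (θ (x, 0) : ℂ))) - ∑ x : TorusSite 2 L, cexp (I * (θ' (x, 0) : ℂ))‖
      ≤ (L : ℝ) ^ 2 * ‖θ - θ'‖ := by
  rw [← Finset.sum_sub_distrib]
  calc ‖∑ x : TorusSite 2 L, (cexp (I * (θ (x, 0) : ℂ)) - cexp (I * (θ' (x, 0) : ℂ)))‖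
      ≤ ∑ x : TorusSite 2 L, ‖cexp (I * (θ (x, 0) : ℂ)) - cexp (I * (θ' (x, 0) : ℂ))‖ :=
        norm_sum_le _ _
    _ ≤ ∑ _x : TorusSite 2 L, ‖θ - θ'‖ := by
        refine Finset.sum_le_sum fun x _ => ?_
        have h1 : cexp (I * (θ (x, 0) : ℂ)) - cexp (I * (θ' (x, 0) : ℂ))
            = cexp (I * (θ' (x, 0) : ℂ)) * (cexp (I * ((θ (x, 0) - θ' (x, 0) : ℝ) : ℂ)) - 1) := by
          rw [mul_sub, mul_one, ← Complex.exp_add]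
          congr 1
          push_cast
          ring_nf
        rw [h1, norm_mul, mul_comm I, Complex.norm_exp_ofReal_mul_I, one_mul]
        refine (Real.norm_exp_I_mul_ofReal_sub_one_le).trans ?_
        have := norm_le_pi_norm (θ - θ') (x, 0)
        simpa using this
    _ = (L : ℝ) ^ 2 * ‖θ - θ'‖ := by
        rw [Finset.sum_const, Finset.card_univ, birLat_card_slice, nsmul_eq_mul]; push_cast; ring

/-- **The slice observable is `2`-Lipschitz** for the sup norm. -/
theorem birUnif_O_lipschitz {O : ((TorusSite 2 L × ZMod M) → ℝ) → ℝ}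
    (hO : ∀ θ, O θ = ‖∑ x : TorusSite 2 L, cexp (I * (θ (x, 0) : ℂ))‖ ^ 2 / (L : ℝ) ^ 4)
    (θ θ' : (TorusSite 2 L × ZMod M) → ℝ) : |O θ - O θ'| ≤ 2 * ‖θ - θ'‖ := by
  have hL : (0 : ℝ) < L := by exact_mod_cast Nat.pos_of_ne_zero (NeZero.ne L)
  set S : ℂ := ∑ x : TorusSite 2 L, cexp (I * (θ (x, 0) : ℂ)) with hS
  set S' : ℂ := ∑ x : TorusSite 2 L, cexp (I * (θ' (x, 0) : ℂ)) with hS'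
  have hSb : ‖S‖ ≤ (L : ℝ) ^ 2 := by
    calc ‖S‖ ≤ ∑ x : TorusSite 2 L, ‖cexp (I * (θ (x, 0) : ℂ))‖ := norm_sum_le _ _
      _ = (L : ℝ) ^ 2 := by
          simp only [mul_comm I, Complex.norm_exp_ofReal_mul_I, Finset.sum_const, Finset.card_univ,
            birLat_card_slice, nsmul_eq_mul, mul_one]; push_cast; ring
  have hSb' : ‖S'‖ ≤ (L : ℝ) ^ 2 := by
    calc ‖S'‖ ≤ ∑ x : TorusSite 2 L, ‖cexp (I * (θ' (x, 0) : ℂ))‖ := norm_sum_le _ _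
      _ = (L : ℝ) ^ 2 := by
          simp only [mul_comm I, Complex.norm_exp_ofReal_mul_I, Finset.sum_const, Finset.card_univ,
            birLat_card_slice, nsmul_eq_mul, mul_one]; push_cast; ring
  have hdiff : ‖S - S'‖ ≤ (L : ℝ) ^ 2 * ‖θ - θ'‖ := birUnif_sliceSum_lipschitz θ θ'
  rw [hO, hO, ← sub_div, abs_div, abs_of_pos (by positivity : (0 : ℝ) < (L : ℝ) ^ 4)]
  rw [div_le_iff₀ (by positivity)]
  have h1 : |‖S‖ ^ 2 - ‖S'‖ ^ 2| = |‖S‖ - ‖S'‖| * (‖S‖ + ‖S'‖) := by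
    rw [sq_sub_sq, abs_mul, abs_of_nonneg (by positivity : 0 ≤ ‖S‖ + ‖S'‖), mul_comm]
  have h2 : |‖S‖ - ‖S'‖| ≤ ‖S - S'‖ := abs_norm_sub_norm_le S S'
  rw [h1]
  calc |‖S‖ - ‖S'‖| * (‖S‖ + ‖S'‖) ≤ ((L : ℝ) ^ 2 * ‖θ - θ'‖) * ((L : ℝ) ^ 2 + (L : ℝ) ^ 2) :=
        mul_le_mul (h2.trans hdiff) (add_le_add hSb hSb') (by positivity) (by positivity)
    _ = 2 * ‖θ - θ'‖ * (L : ℝ) ^ 4 := by ring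

/-- The extension by zero is `1`-Lipschitz at `0`: `‖ext δ − ext 0‖ ≤ ‖δ‖`. -/
theorem birUnif_norm_ext_le (s₀ : TorusSite 2 L × ZMod M) (δ : {i // i ≠ s₀} → ℝ) :
    ‖(fun i : TorusSite 2 L × ZMod M => if h : i = s₀ then (0 : ℝ) else δ ⟨i, h⟩)
        - (fun i : TorusSite 2 L × ZMod M => if h : i = s₀ then (0 : ℝ) else (0 : {i // i ≠ s₀} → ℝ) ⟨i, h⟩)‖
      ≤ ‖δ‖ := by
  refine (pi_norm_le_iff_of_nonneg (norm_nonneg _)).2 fun i => ?_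
  simp only [Pi.sub_apply]
  by_cases h : i = s₀
  · simp [h]
  · simp only [h, dif_neg, not_false_eq_true, Pi.zero_apply, sub_zero]
    exact norm_le_pi_norm δ ⟨i, h⟩

end Lipschitz

end Summit.HubbardSuperconductivity.HubbardSuperconductivity.Theorems
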